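/-
Copyright: statement-level skeleton of a published paper (lit-balaban cell, Phase-2 proof seat p39 gen 16). No proof claims
beyond what the kernel checks below.
-/
import Literature.MathematicalPhysics.QuantumFieldTheory.Balaban1983to89.B3WT228Graphs
import Literature.MathematicalPhysics.QuantumFieldTheory.Balaban1983to89.B3WT224HigherOrder

/-!
# B3 — T. Bałaban, *(Higgs)₂,₃ quantum fields in a finite volume. III. Renormalization*, CMP **88** (1983) 411–445
[Balaban1983Higgs3], p. 430 *"calculating the Gaussian integrals"* / p. 434 *"tr q^{2n+1} = 0"*: **Wick's theorem for products of
CURRENTS (bilinear vertices `⟪φ(x),Qφ(y)⟫`) on the concrete lattice model — the first-current recursion (loop expansion) — and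
its consequence, the vanishing of every Gaussian integral of currents carrying an odd total power of `q` (Furry's theorem
for the lattice model; the p. 434 mechanism at the level of the Gaussian integrals)**

statement-level skeleton of published theorems with citation tags; proofs where landed; nothing here is a claim about
the Yang–Mills mass gap

PDF held: `paper:balaban1983-higgs-2-3-quantum-fields-finite-volume` (journal page = PDF page + 410); p. 430 [PDF 20], p. 431 [PDF 21],
p. 434 [PDF 24] read (`lit read`).

CITATION HEADER (lean-in-tree rule).  Part of the lit-balaban TYPED SKELETON (HOME `run/shared/lean/pub/lit-balaban/`), PHASE 2,
proof seat p39 (generation 16).  Rows **B3.Eq2.26-2.28** (p. 431: the Gaussian integrals of the Ward–Takahashi identities are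
integrals of products of currents — this seat's `B3WT224HigherOrder` writes the identities of ALL orders as such products,
`B3WT224HigherOrder.cur`) and **B3.Txt@434** (p. 434, verbatim: *"the expressions corresponding to graphs with an odd number of
external vector field legs (and no other external legs) are equal to 0 … every graph of this type has at least one loop of scalar
field lines with an odd number of vector field legs, thus with an odd power of q, and we have tr q^{2n+1} = 0"*; owner r15, head
`proved` on the graph model `B3Cor23Concrete` by p18's `B3OddVectorLoopsVanish`).  THIS FILE proves the same mechanism for the
GAUSSIAN INTEGRALS of the lattice model of `B3WT223Instance`/`B3WT224Instance` (fields `φ : T^{(j)} → R^N`, weight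
`e^{−½⟨φ,(−Δ^η+M²)φ⟩}`, propagator `C^η_{M²} = G` of `B3WTPropagator`), by Gaussian integration by parts in the engine form of this
seat's gen-14 `B3WickVertexCalculus` (`ExpGrowth`, `DerivAlong`, `ibp_site`) and `B3WT228Graphs` (`derivAlong_biq`,
`expGrowth_biq`, `expGrowth_const_inner_op`), all BY NAME.

WHAT THIS FILE PROVES (theorems; one bookkeeping structure `QLeg` with body; no named fact, no `sorry`).
* §1 products of observables: `expGrowth_prod`, `derivAlong_prod` (Leibniz rule along a line for a finite product).
* §2 **THE FIRST-CURRENT RECURSION** (`integral_bil_mul_prod`, split form `integral_bil_mul_prod_split`): for a current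
  `⟪φ(x),Qφ(y)⟫` against a product of currents `∏_{l∈s}⟪φ(x_l),Q_lφ(y_l)⟫`,
  `∫W·⟪φ(x),Qφ(y)⟫·∏_{l∈s}(…) = C(x,y)·tr Q·∫W·∏_{l∈s}(…)
     + Σ_{l∈s} [ C(x,x_l)·∫W·⟪φ(y),Q*Q_lφ(y_l)⟫·∏_{l'∈s∖l}(…) + C(x,y_l)·∫W·⟪φ(y),Q*Q_l*φ(x_l)⟫·∏_{l'∈s∖l}(…) ]`
  (`W = e^{−½⟨φ,(−Δ^η+M²)φ⟩}`, `C = C^η_{M²}`): the leg `φ(x)` either closes on its own current (a loop, `tr Q`) or is contracted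
  into the `x_l`- or `y_l`-leg of another current, which MERGES the two currents into one (`Q*Q_l`, resp. `Q*Q_l*`) — applying it
  `k` times evaluates any Gaussian integral of `k` currents into propagators and traces of words in the `Q`'s (p. 430 *"calculating
  the Gaussian integrals"*; p. 414 *"each pair is replaced by the corresponding propagator"*).
* §3 **two currents in closed form** (`integral_bil_bil`):
  `∫W⟪φ(x₁),Q₁φ(y₁)⟫⟪φ(x₂),Q₂φ(y₂)⟫
     = Z·[C(x₁,y₁)C(x₂,y₂)trQ₁trQ₂ + C(x₁,x₂)C(y₁,y₂)tr(Q₁*Q₂) + C(x₁,y₂)C(y₁,x₂)tr(Q₁*Q₂*)]`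
  (the three pairings; `B3WTWick.moment_qq` is the instance `Q₁ = Q₂ = q`).
* §4 **FURRY'S THEOREM FOR THE LATTICE MODEL = the p. 434 mechanism for Gaussian integrals** (`integral_prod_qleg_eq_zero_of_odd`):
  for currents `⟪φ(x_l), σ_l q^{m_l} φ(y_l)⟫` (`q* = −q`, B1 p. 605) with `Σ_l m_l` ODD, `∫W·∏_l⟪φ(x_l),σ_lq^{m_l}φ(y_l)⟫ = 0` — by
  induction on the number of currents with the recursion: a loop closing with an odd power has `tr q^{2n+1} = 0`
  (`trE_smul_qpow_odd`, from `⟪v,q^mv⟫ = 0` for odd `m`), a loop closing with an even power leaves an odd total behind, and a merge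
  `q^m* q^{m'} = ±q^{m+m'}` preserves the total (`adjoint_qpow`, `adjoint_smul_qpow`, `sq_apply_sq`).  In particular every Wick term of an
  EVEN-order identity of `B3WT224HigherOrder` at `F = 1` (total `q`-degree = order + 1, odd) vanishes separately — the first
  higher-order Ward–Takahashi identities with non-trivial pictures are of order three (four vector legs).
HONEST SCOPE: the zero-background Gaussian `e^{−½⟨φ,(−Δ^η+M²)φ⟩}dφ` of the model torus; currents = bilinear vertices with
constant operators on `R^N`; no external scalar legs.  Mathlib + the cited tree files only; standard axioms.
Unit `lit-balaban-p39-g16` (Phase-2 proof seat p39, gen 16), HOME `run/shared/lean/pub/lit-balaban/`, 2026-08-22.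

References: [Balaban1983Higgs3] T. Bałaban, CMP 88 (1983) 411–445, pp. 414, 430–431, 434; [Balaban1982Higgs1] T. Bałaban, CMP 85
(1982) 603–636, (1.7) p. 605; [GlimmJaffeQP1987] J. Glimm, A. Jaffe, *Quantum Physics* (2nd ed., Springer 1987), Thm 6.3.1 (6.3.3),
§8.2 (8.2.1)–(8.2.4).
-/

noncomputable section

open scoped BigOperators InnerProductSpace

namespace Literature.MathematicalPhysics.QuantumFieldTheory.Balaban1983to89.B3BilinearWick

open _root_.MeasureTheory
open LatticeFieldCalculus B3WT223Instance B3WT224Instance B3WTPropagator B3WTCovariance B3WTWick B3WickVertexCalculus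
  B3WT228Graphs B3WT226Pairings B3WT224HigherOrder

variable {P : Params} {j N : ℕ} (C : HiggsLattice.ChargeData N) (η w c M2 : ℝ)

/-- the Gaussian weight `W(φ) = e^{−½⟨φ,Kφ⟩}` of `dμ_{C^η_{M²}}` (notation local to this file). -/
local notation "W" => weight C η w c M2 (0 : VecField P j ℝ)

/-- the standard orthonormal basis vector `e_a` of `R^N` (notation local to this file). -/
local notation "𝐞" => EuclideanSpace.basisFun (Fin N) ℝ

/-! ## §1 Products of observables: growth and the Leibniz rule along a line -/

omit C η w c M2 in
/-- a finite product of observables of exponential-linear growth has exponential-linear growth.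
[cite: Balaban1983Higgs3, (2.24) p.430 (the admissible F)] -/
theorem expGrowth_prod {ι : Type*} (s : Finset ι) {f : ι → Cfg P j N → ℝ} (h : ∀ i ∈ s, ExpGrowth (f i)) :
    ExpGrowth (fun φ => ∏ i ∈ s, f i φ) := by
  classical
  induction s using Finset.induction_on with
  | empty => simpa using ExpGrowth.const (P := P) (j := j) (N := N) 1
  | insert a s ha ih =>
      have h' := (h a (Finset.mem_insert_self a s)).mul (ih fun i hi => h i (Finset.mem_insert_of_mem hi))
      simpa [Finset.prod_insert ha] using h'

omit C η w c M2 in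
/-- the Leibniz rule along a line for a finite product: `D_h∏_{i∈s}f_i = Σ_{i∈s}(∏_{l∈s∖i}f_l)·D_hf_i`.
[cite: GlimmJaffeQP1987, (9.1.3)] -/
theorem derivAlong_prod {ι : Type*} [DecidableEq ι] (h : Cfg P j N) (s : Finset ι) {f f' : ι → Cfg P j N → ℝ}
    (hf : ∀ i ∈ s, DerivAlong h (f i) (f' i)) :
    DerivAlong h (fun φ => ∏ i ∈ s, f i φ) (fun φ => ∑ i ∈ s, (∏ l ∈ s.erase i, f l φ) * f' i φ) := by
  intro φ t
  have hd := HasDerivAt.fun_finsetProd (u := s) (f := fun i (t' : ℝ) => f i (φ + t' • h))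
    (f' := fun i => f' i (φ + t • h)) (x := t) (fun i hi => hf i hi φ t)
  simpa only [smul_eq_mul] using hd

/-! ## §2 The first-current recursion -/

omit C η in
/-- `⟪φ(x),Qφ(y)⟫ = Σ_a ⟪φ(x),e_a⟫⟪φ(y),Q*e_a⟫` — the current split into its `x`-leg components. [cite: GlimmJaffeQP1987, §8.2 (8.2.1)] -/
theorem bil_eq_sum_legs (x y : Site P j) (Q : EuclideanSpace ℝ (Fin N) →L[ℝ] EuclideanSpace ℝ (Fin N))
    (φ : Cfg P j N) :
    ⟪φ x, Q (φ y)⟫_ℝ = ∑ a : Fin N, ⟪φ x, 𝐞 a⟫_ℝ * ⟪φ y, ContinuousLinearMap.adjoint Q (𝐞 a)⟫_ℝ := by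
  rw [← (EuclideanSpace.basisFun (Fin N) ℝ).sum_inner_mul_inner (φ x) (Q (φ y))]
  refine Finset.sum_congr rfl fun a _ => ?_
  rw [← ContinuousLinearMap.adjoint_inner_left, real_inner_comm (φ y)]

omit C η in
/-- `Σ_a ⟪h_{x,a}(y), Q*e_a⟫ = C(y,x)·tr Q` — the leg `φ(x)` closing on its own current gives a loop with the trace of `Q`.
[cite: Balaban1983Higgs3, (2.26) p.431] -/
theorem sum_inner_hx_adjoint (x y : Site P j) (Q : EuclideanSpace ℝ (Fin N) →L[ℝ] EuclideanSpace ℝ (Fin N)) :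
    ∑ a : Fin N, ⟪hx w c M2 x a y, ContinuousLinearMap.adjoint Q (𝐞 a)⟫_ℝ = G w c M2 y x * trE Q := by
  rw [trE, Finset.mul_sum]
  refine Finset.sum_congr rfl fun a _ => ?_
  rw [inner_hx_left, ContinuousLinearMap.adjoint_inner_right, real_inner_comm (𝐞 a)]

omit C η in
/-- `Σ_a ⟪φ(y),Q*e_a⟫⟪e_a,Q'u⟫ = ⟪φ(y), Q*Q'u⟫` — a leg contracted into the `x`-leg of another current merges the currents.
[cite: GlimmJaffeQP1987, §8.2 (8.2.1)] -/
theorem sum_leg_mul_leg_left (y : Site P j) (Q Q' : EuclideanSpace ℝ (Fin N) →L[ℝ] EuclideanSpace ℝ (Fin N))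
    (u : EuclideanSpace ℝ (Fin N)) (φ : Cfg P j N) :
    ∑ a : Fin N, ⟪φ y, ContinuousLinearMap.adjoint Q (𝐞 a)⟫_ℝ * ⟪𝐞 a, Q' u⟫_ℝ =
      ⟪φ y, ContinuousLinearMap.adjoint Q (Q' u)⟫_ℝ := by
  have h : ∀ a : Fin N, ⟪φ y, ContinuousLinearMap.adjoint Q (𝐞 a)⟫_ℝ = ⟪Q (φ y), 𝐞 a⟫_ℝ := fun a =>
    ContinuousLinearMap.adjoint_inner_right _ _ _
  simp_rw [h]
  rw [(EuclideanSpace.basisFun (Fin N) ℝ).sum_inner_mul_inner, ContinuousLinearMap.adjoint_inner_right Q (φ y) (Q' u)]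

omit C η in
/-- `Σ_a ⟪φ(y),Q*e_a⟫⟪u,Q'e_a⟫ = ⟪φ(y), Q*Q'*u⟫` — a leg contracted into the `y`-leg of another current merges the currents with the
second one transposed. [cite: GlimmJaffeQP1987, §8.2 (8.2.1)] -/
theorem sum_leg_mul_leg_right (y : Site P j) (Q Q' : EuclideanSpace ℝ (Fin N) →L[ℝ] EuclideanSpace ℝ (Fin N))
    (u : EuclideanSpace ℝ (Fin N)) (φ : Cfg P j N) :
    ∑ a : Fin N, ⟪φ y, ContinuousLinearMap.adjoint Q (𝐞 a)⟫_ℝ * ⟪u, Q' (𝐞 a)⟫_ℝ =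
      ⟪φ y, ContinuousLinearMap.adjoint Q (ContinuousLinearMap.adjoint Q' u)⟫_ℝ := by
  have h : ∀ a : Fin N, ⟪φ y, ContinuousLinearMap.adjoint Q (𝐞 a)⟫_ℝ * ⟪u, Q' (𝐞 a)⟫_ℝ =
      ⟪Q (φ y), 𝐞 a⟫_ℝ * ⟪𝐞 a, ContinuousLinearMap.adjoint Q' u⟫_ℝ := fun a => by
    rw [ContinuousLinearMap.adjoint_inner_right, ← ContinuousLinearMap.adjoint_inner_left Q' (𝐞 a) u,
      real_inner_comm (𝐞 a) (ContinuousLinearMap.adjoint Q' u)]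
  simp_rw [h]
  rw [(EuclideanSpace.basisFun (Fin N) ℝ).sum_inner_mul_inner,
    ContinuousLinearMap.adjoint_inner_right Q (φ y) (ContinuousLinearMap.adjoint Q' u)]

/-- **THE FIRST-CURRENT RECURSION (integrand form)**: for a current `⟪φ(x),Qφ(y)⟫` against a product of currents,
`∫W⟪φ(x),Qφ(y)⟫∏_{l∈s}⟪φ(x_l),Q_lφ(y_l)⟫
   = ∫W·[C(x,y)trQ·∏_{l∈s}(…) + Σ_{l∈s}(C(x,x_l)⟪φ(y),Q*Q_lφ(y_l)⟫ + C(x,y_l)⟪φ(y),Q*Q_l*φ(x_l)⟫)∏_{l'∈s∖l}(…)]`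
— Gaussian integration by parts of the leg `φ(x)` (`B3WickVertexCalculus.ibp_site`, componentwise in the basis `e_a`): it closes on its
own current (the loop `C(x,y)tr Q`) or is contracted into either leg of another current, merging the two (Glimm–Jaffe (8.2.1) for
bilinear vertices; p. 430 *"calculating the Gaussian integrals"*). [cite: Balaban1983Higgs3, (2.26) p.431; p.430]
[cite: GlimmJaffeQP1987, Thm 6.3.1 (6.3.3); §8.2 (8.2.1)] -/
theorem integral_bil_mul_prod (hw : 0 < w) (hM : 0 < M2) (x y : Site P j)
    (Q : EuclideanSpace ℝ (Fin N) →L[ℝ] EuclideanSpace ℝ (Fin N)) {ι : Type*} [DecidableEq ι] (s : Finset ι)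
    (xs ys : ι → Site P j) (Qs : ι → EuclideanSpace ℝ (Fin N) →L[ℝ] EuclideanSpace ℝ (Fin N)) :
    ∫ φ, W φ * (⟪φ x, Q (φ y)⟫_ℝ * ∏ l ∈ s, ⟪φ (xs l), Qs l (φ (ys l))⟫_ℝ) =
      ∫ φ, W φ * (G w c M2 x y * trE Q * ∏ l ∈ s, ⟪φ (xs l), Qs l (φ (ys l))⟫_ℝ
        + ∑ l ∈ s, (G w c M2 x (xs l) * ⟪φ y, ContinuousLinearMap.adjoint Q (Qs l (φ (ys l)))⟫_ℝ
            + G w c M2 x (ys l) * ⟪φ y, ContinuousLinearMap.adjoint Q (ContinuousLinearMap.adjoint (Qs l) (φ (xs l)))⟫_ℝ) *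
          ∏ l' ∈ s.erase l, ⟪φ (xs l'), Qs l' (φ (ys l'))⟫_ℝ) := by
  -- the product `R` of the other currents, the partial products `Rl`, growth and derivatives
  set R : Cfg P j N → ℝ := fun φ => ∏ l ∈ s, ⟪φ (xs l), Qs l (φ (ys l))⟫_ℝ with hR
  set Rl : ι → Cfg P j N → ℝ := fun l φ => ∏ l' ∈ s.erase l, ⟪φ (xs l'), Qs l' (φ (ys l'))⟫_ℝ with hRl
  have hRg : ExpGrowth R := expGrowth_prod s fun l _ => expGrowth_biq (xs l) (ys l) (Qs l)
  have hRlg : ∀ l, ExpGrowth (Rl l) := fun l => expGrowth_prod _ fun l' _ => expGrowth_biq (xs l') (ys l') (Qs l')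
  have hRd : ∀ a : Fin N, DerivAlong (hx w c M2 x a) R (fun φ => ∑ l ∈ s, Rl l φ *
      (G w c M2 (xs l) x * ⟪𝐞 a, Qs l (φ (ys l))⟫_ℝ + G w c M2 (ys l) x * ⟪φ (xs l), Qs l (𝐞 a)⟫_ℝ)) :=
    fun a => derivAlong_prod _ s fun l _ => derivAlong_biq w c M2 x a (xs l) (ys l) (Qs l)
  -- the `y`-leg vectors `v_a = Q*e_a`, the integrands `g_a = ⟪φ(y),v_a⟫R` and their derivatives `g'_a` along `h_{x,a}`
  set v : Fin N → EuclideanSpace ℝ (Fin N) := fun a => ContinuousLinearMap.adjoint Q (𝐞 a) with hv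
  set g : Fin N → Cfg P j N → ℝ := fun a φ => ⟪φ y, v a⟫_ℝ * R φ with hg
  set g' : Fin N → Cfg P j N → ℝ := fun a φ => ⟪hx w c M2 x a y, v a⟫_ℝ * R φ + ⟪φ y, v a⟫_ℝ *
    (∑ l ∈ s, Rl l φ * (G w c M2 (xs l) x * ⟪𝐞 a, Qs l (φ (ys l))⟫_ℝ + G w c M2 (ys l) x * ⟪φ (xs l), Qs l (𝐞 a)⟫_ℝ))
    with hg'
  have hgD : ∀ a, DerivAlong (hx w c M2 x a) (g a) (g' a) := fun a =>
    (DerivAlong.inner_apply (hx w c M2 x a) y (v a)).mul (hRd a)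
  have hgG : ∀ a, ExpGrowth (g a) := fun a => (ExpGrowth.inner_apply y (v a)).mul hRg
  have hg'G : ∀ a, ExpGrowth (g' a) := fun a =>
    ((ExpGrowth.const _).mul hRg).add ((ExpGrowth.inner_apply y (v a)).mul (ExpGrowth.sum s fun l _ =>
      (hRlg l).mul (((expGrowth_const_inner_op (𝐞 a) (ys l) (Qs l)).const_mul _).add
        ((ExpGrowth.inner_apply (xs l) (Qs l (𝐞 a))).const_mul _))))
  -- step 1: split the `x`-leg into components
  have h1 : ∫ φ, W φ * (⟪φ x, Q (φ y)⟫_ℝ * R φ) = ∑ a : Fin N, ∫ φ, W φ * (⟪φ x, 𝐞 a⟫_ℝ * g a φ) := by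
    rw [← integral_finsetSum _ (fun a _ =>
      ExpGrowth.integrable C η w c M2 hw hM ((ExpGrowth.inner_apply x (𝐞 a)).mul (hgG a)))]
    refine integral_congr_ae (Filter.Eventually.of_forall fun φ => ?_)
    show W φ * (⟪φ x, Q (φ y)⟫_ℝ * R φ) = ∑ a : Fin N, W φ * (⟪φ x, 𝐞 a⟫_ℝ * g a φ)
    rw [bil_eq_sum_legs, Finset.sum_mul, Finset.mul_sum]
    refine Finset.sum_congr rfl fun a _ => ?_
    simp only [hg]
    ring
  -- step 2: integrate each component by parts
  have h2 : ∀ a : Fin N, ∫ φ, W φ * (⟪φ x, 𝐞 a⟫_ℝ * g a φ) = ∫ φ, W φ * g' a φ := fun a =>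
    ibp_site C η w c M2 hw hM x a (hgG a) (hg'G a) (hgD a)
  -- step 3: resum the components
  have h3 : ∀ φ : Cfg P j N, ∑ a : Fin N, g' a φ = G w c M2 x y * trE Q * R φ
      + ∑ l ∈ s, (G w c M2 x (xs l) * ⟪φ y, ContinuousLinearMap.adjoint Q (Qs l (φ (ys l)))⟫_ℝ
          + G w c M2 x (ys l) * ⟪φ y, ContinuousLinearMap.adjoint Q (ContinuousLinearMap.adjoint (Qs l) (φ (xs l)))⟫_ℝ) *
        Rl l φ := by
    intro φ
    have e1 := sum_inner_hx_adjoint w c M2 x y Q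
    have e2 : ∀ l, ∑ a : Fin N, ⟪φ y, v a⟫_ℝ * ⟪𝐞 a, Qs l (φ (ys l))⟫_ℝ =
        ⟪φ y, ContinuousLinearMap.adjoint Q (Qs l (φ (ys l)))⟫_ℝ := fun l => sum_leg_mul_leg_left y Q (Qs l) _ φ
    have e3 : ∀ l, ∑ a : Fin N, ⟪φ y, v a⟫_ℝ * ⟪φ (xs l), Qs l (𝐞 a)⟫_ℝ =
        ⟪φ y, ContinuousLinearMap.adjoint Q (ContinuousLinearMap.adjoint (Qs l) (φ (xs l)))⟫_ℝ := fun l =>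
      sum_leg_mul_leg_right y Q (Qs l) _ φ
    have e4 : ∀ l ∈ s, ∑ a : Fin N, ⟪φ y, v a⟫_ℝ * (Rl l φ *
        (G w c M2 (xs l) x * ⟪𝐞 a, Qs l (φ (ys l))⟫_ℝ + G w c M2 (ys l) x * ⟪φ (xs l), Qs l (𝐞 a)⟫_ℝ)) =
        (G w c M2 x (xs l) * ⟪φ y, ContinuousLinearMap.adjoint Q (Qs l (φ (ys l)))⟫_ℝ
          + G w c M2 x (ys l) * ⟪φ y, ContinuousLinearMap.adjoint Q (ContinuousLinearMap.adjoint (Qs l) (φ (xs l)))⟫_ℝ) *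
        Rl l φ := by
      intro l _
      rw [← e2 l, ← e3 l, G_symm w c M2 x (xs l), G_symm w c M2 x (ys l), Finset.mul_sum, Finset.mul_sum,
        ← Finset.sum_add_distrib, Finset.sum_mul]
      exact Finset.sum_congr rfl fun a _ => by ring
    calc ∑ a : Fin N, g' a φ
        = (∑ a : Fin N, ⟪hx w c M2 x a y, v a⟫_ℝ) * R φ
          + ∑ a : Fin N, ⟪φ y, v a⟫_ℝ * ∑ l ∈ s, Rl l φ *
              (G w c M2 (xs l) x * ⟪𝐞 a, Qs l (φ (ys l))⟫_ℝ + G w c M2 (ys l) x * ⟪φ (xs l), Qs l (𝐞 a)⟫_ℝ) := by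
          simp only [hg']
          rw [Finset.sum_add_distrib, Finset.sum_mul]
      _ = G w c M2 x y * trE Q * R φ
          + ∑ l ∈ s, ∑ a : Fin N, ⟪φ y, v a⟫_ℝ * (Rl l φ *
              (G w c M2 (xs l) x * ⟪𝐞 a, Qs l (φ (ys l))⟫_ℝ + G w c M2 (ys l) x * ⟪φ (xs l), Qs l (𝐞 a)⟫_ℝ)) := by
          rw [e1, G_symm w c M2 y x]
          congr 1
          simp_rw [Finset.mul_sum]
          exact Finset.sum_comm
      _ = _ := congrArg₂ (· + ·) rfl (Finset.sum_congr rfl e4)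
  -- step 4: assemble
  rw [h1]
  simp_rw [h2]
  rw [← integral_finsetSum _ (fun a _ => ExpGrowth.integrable C η w c M2 hw hM (hg'G a))]
  refine integral_congr_ae (Filter.Eventually.of_forall fun φ => ?_)
  dsimp only
  rw [← Finset.mul_sum, h3 φ]

/-- growth of the merged currents times the remaining product (integrability bookkeeping). [cite: Balaban1983Higgs3, (2.26) p.431] -/
theorem expGrowth_merge {ι : Type*} [DecidableEq ι] (x y : Site P j) (Q : EuclideanSpace ℝ (Fin N) →L[ℝ] EuclideanSpace ℝ (Fin N))
    (s : Finset ι) (xs ys : ι → Site P j) (Qs : ι → EuclideanSpace ℝ (Fin N) →L[ℝ] EuclideanSpace ℝ (Fin N)) (l : ι) :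
    ExpGrowth (fun φ : Cfg P j N =>
      (G w c M2 x (xs l) * ⟪φ y, ContinuousLinearMap.adjoint Q (Qs l (φ (ys l)))⟫_ℝ
        + G w c M2 x (ys l) * ⟪φ y, ContinuousLinearMap.adjoint Q (ContinuousLinearMap.adjoint (Qs l) (φ (xs l)))⟫_ℝ) *
      ∏ l' ∈ s.erase l, ⟪φ (xs l'), Qs l' (φ (ys l'))⟫_ℝ) :=
  (((expGrowth_biq y (ys l) ((ContinuousLinearMap.adjoint Q).comp (Qs l))).const_mul _).add
    ((expGrowth_biq y (xs l) ((ContinuousLinearMap.adjoint Q).comp (ContinuousLinearMap.adjoint (Qs l)))).const_mul _)).mul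
    (expGrowth_prod _ fun l' _ => expGrowth_biq (xs l') (ys l') (Qs l'))

/-- **THE FIRST-CURRENT RECURSION (split form)**:
`∫W⟪φ(x),Qφ(y)⟫∏_{l∈s}(…) = C(x,y)·trQ·∫W∏_{l∈s}(…)
   + Σ_{l∈s}[C(x,x_l)∫W⟪φ(y),Q*Q_lφ(y_l)⟫∏_{l'≠l}(…) + C(x,y_l)∫W⟪φ(y),Q*Q_l*φ(x_l)⟫∏_{l'≠l}(…)]`
— each term is again a Gaussian integral of a product of currents with one current fewer, so `k` applications evaluate any
integral of `k` currents (the loop expansion). [cite: Balaban1983Higgs3, (2.26) p.431; p.430] [cite: GlimmJaffeQP1987, §8.2 (8.2.4)] -/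
theorem integral_bil_mul_prod_split (hw : 0 < w) (hM : 0 < M2) (x y : Site P j)
    (Q : EuclideanSpace ℝ (Fin N) →L[ℝ] EuclideanSpace ℝ (Fin N)) {ι : Type*} [DecidableEq ι] (s : Finset ι)
    (xs ys : ι → Site P j) (Qs : ι → EuclideanSpace ℝ (Fin N) →L[ℝ] EuclideanSpace ℝ (Fin N)) :
    ∫ φ, W φ * (⟪φ x, Q (φ y)⟫_ℝ * ∏ l ∈ s, ⟪φ (xs l), Qs l (φ (ys l))⟫_ℝ) =
      G w c M2 x y * trE Q * (∫ φ, W φ * ∏ l ∈ s, ⟪φ (xs l), Qs l (φ (ys l))⟫_ℝ)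
      + ∑ l ∈ s, (G w c M2 x (xs l) *
            (∫ φ, W φ * (⟪φ y, ContinuousLinearMap.adjoint Q (Qs l (φ (ys l)))⟫_ℝ *
              ∏ l' ∈ s.erase l, ⟪φ (xs l'), Qs l' (φ (ys l'))⟫_ℝ))
          + G w c M2 x (ys l) *
            (∫ φ, W φ * (⟪φ y, ContinuousLinearMap.adjoint Q (ContinuousLinearMap.adjoint (Qs l) (φ (xs l)))⟫_ℝ *
              ∏ l' ∈ s.erase l, ⟪φ (xs l'), Qs l' (φ (ys l'))⟫_ℝ))) := by
  rw [integral_bil_mul_prod C η w c M2 hw hM x y Q s xs ys Qs]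
  have hR : ExpGrowth (fun φ : Cfg P j N => ∏ l ∈ s, ⟪φ (xs l), Qs l (φ (ys l))⟫_ℝ) :=
    expGrowth_prod s fun l _ => expGrowth_biq (xs l) (ys l) (Qs l)
  have hI0 := ExpGrowth.integrable C η w c M2 hw hM (hR.const_mul (G w c M2 x y * trE Q))
  have hIl : ∀ l ∈ s, Integrable (fun φ : Cfg P j N => W φ *
      ((G w c M2 x (xs l) * ⟪φ y, ContinuousLinearMap.adjoint Q (Qs l (φ (ys l)))⟫_ℝ
        + G w c M2 x (ys l) * ⟪φ y, ContinuousLinearMap.adjoint Q (ContinuousLinearMap.adjoint (Qs l) (φ (xs l)))⟫_ℝ) *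
      ∏ l' ∈ s.erase l, ⟪φ (xs l'), Qs l' (φ (ys l'))⟫_ℝ)) := fun l _ =>
    ExpGrowth.integrable C η w c M2 hw hM (expGrowth_merge w c M2 x y Q s xs ys Qs l)
  have hIsum := integrable_finsetSum s hIl
  have hsplit : ∀ φ : Cfg P j N, W φ * (G w c M2 x y * trE Q * ∏ l ∈ s, ⟪φ (xs l), Qs l (φ (ys l))⟫_ℝ
      + ∑ l ∈ s, (G w c M2 x (xs l) * ⟪φ y, ContinuousLinearMap.adjoint Q (Qs l (φ (ys l)))⟫_ℝ
          + G w c M2 x (ys l) * ⟪φ y, ContinuousLinearMap.adjoint Q (ContinuousLinearMap.adjoint (Qs l) (φ (xs l)))⟫_ℝ) *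
        ∏ l' ∈ s.erase l, ⟪φ (xs l'), Qs l' (φ (ys l'))⟫_ℝ)
      = W φ * (G w c M2 x y * trE Q * ∏ l ∈ s, ⟪φ (xs l), Qs l (φ (ys l))⟫_ℝ)
        + ∑ l ∈ s, W φ * ((G w c M2 x (xs l) * ⟪φ y, ContinuousLinearMap.adjoint Q (Qs l (φ (ys l)))⟫_ℝ
          + G w c M2 x (ys l) * ⟪φ y, ContinuousLinearMap.adjoint Q (ContinuousLinearMap.adjoint (Qs l) (φ (xs l)))⟫_ℝ) *
        ∏ l' ∈ s.erase l, ⟪φ (xs l'), Qs l' (φ (ys l'))⟫_ℝ) := fun φ => by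
    rw [mul_add, Finset.mul_sum]
  simp_rw [hsplit]
  rw [integral_add hI0 hIsum, integral_finsetSum s hIl]
  congr 1
  · rw [← integral_const_mul (G w c M2 x y * trE Q)]
    refine integral_congr_ae (Filter.Eventually.of_forall fun φ => ?_)
    ring
  · refine Finset.sum_congr rfl fun l hl => ?_
    have hA : Integrable (fun φ : Cfg P j N => W φ * (⟪φ y, ContinuousLinearMap.adjoint Q (Qs l (φ (ys l)))⟫_ℝ *
        ∏ l' ∈ s.erase l, ⟪φ (xs l'), Qs l' (φ (ys l'))⟫_ℝ)) := by
      have h := ExpGrowth.integrable C η w c M2 hw hM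
        (((expGrowth_biq y (ys l) ((ContinuousLinearMap.adjoint Q).comp (Qs l))).mul
          (expGrowth_prod (s.erase l) fun l' _ => expGrowth_biq (xs l') (ys l') (Qs l'))))
      simpa only [ContinuousLinearMap.comp_apply] using h
    have hB : Integrable (fun φ : Cfg P j N => W φ *
        (⟪φ y, ContinuousLinearMap.adjoint Q (ContinuousLinearMap.adjoint (Qs l) (φ (xs l)))⟫_ℝ *
          ∏ l' ∈ s.erase l, ⟪φ (xs l'), Qs l' (φ (ys l'))⟫_ℝ)) := by
      have h := ExpGrowth.integrable C η w c M2 hw hM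
        (((expGrowth_biq y (xs l) ((ContinuousLinearMap.adjoint Q).comp (ContinuousLinearMap.adjoint (Qs l)))).mul
          (expGrowth_prod (s.erase l) fun l' _ => expGrowth_biq (xs l') (ys l') (Qs l'))))
      simpa only [ContinuousLinearMap.comp_apply] using h
    have e : ∀ φ : Cfg P j N, W φ *
        ((G w c M2 x (xs l) * ⟪φ y, ContinuousLinearMap.adjoint Q (Qs l (φ (ys l)))⟫_ℝ
          + G w c M2 x (ys l) * ⟪φ y, ContinuousLinearMap.adjoint Q (ContinuousLinearMap.adjoint (Qs l) (φ (xs l)))⟫_ℝ) *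
        ∏ l' ∈ s.erase l, ⟪φ (xs l'), Qs l' (φ (ys l'))⟫_ℝ)
        = G w c M2 x (xs l) * (W φ * (⟪φ y, ContinuousLinearMap.adjoint Q (Qs l (φ (ys l)))⟫_ℝ *
            ∏ l' ∈ s.erase l, ⟪φ (xs l'), Qs l' (φ (ys l'))⟫_ℝ))
          + G w c M2 x (ys l) * (W φ *
            (⟪φ y, ContinuousLinearMap.adjoint Q (ContinuousLinearMap.adjoint (Qs l) (φ (xs l)))⟫_ℝ *
              ∏ l' ∈ s.erase l, ⟪φ (xs l'), Qs l' (φ (ys l'))⟫_ℝ)) := fun φ => by ring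
    simp_rw [e]
    rw [integral_add (hA.const_mul _) (hB.const_mul _), integral_const_mul, integral_const_mul]

/-! ## §3 Two currents in closed form -/

/-- **two currents**: `∫W⟪φ(x₁),Q₁φ(y₁)⟫⟪φ(x₂),Q₂φ(y₂)⟫ =
Z·[C(x₁,y₁)trQ₁·C(x₂,y₂)trQ₂ + C(x₁,x₂)C(y₁,y₂)tr(Q₁*Q₂) + C(x₁,y₂)C(y₁,x₂)tr(Q₁*Q₂*)]`
— the three pairings of four legs: two
loops, or one loop through both currents in either orientation (`B3WTWick.moment_qq`/`B3WTCovariance.moment2_op` are the instances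
used in (2.26)). [cite: Balaban1983Higgs3, (2.26) p.431] [cite: GlimmJaffeQP1987, §8.2 (8.2.4)] -/
theorem integral_bil_bil (hw : 0 < w) (hM : 0 < M2) (x₁ y₁ x₂ y₂ : Site P j)
    (Q₁ Q₂ : EuclideanSpace ℝ (Fin N) →L[ℝ] EuclideanSpace ℝ (Fin N)) :
    ∫ φ, W φ * (⟪φ x₁, Q₁ (φ y₁)⟫_ℝ * ⟪φ x₂, Q₂ (φ y₂)⟫_ℝ) =
      (∫ φ, W φ) *
        (G w c M2 x₁ y₁ * trE Q₁ * (G w c M2 x₂ y₂ * trE Q₂)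
          + G w c M2 x₁ x₂ * (G w c M2 y₁ y₂ * trE ((ContinuousLinearMap.adjoint Q₁).comp Q₂))
          + G w c M2 x₁ y₂ * (G w c M2 y₁ x₂ *
              trE ((ContinuousLinearMap.adjoint Q₁).comp (ContinuousLinearMap.adjoint Q₂)))) := by
  have h := integral_bil_mul_prod_split C η w c M2 hw hM x₁ y₁ Q₁ (Finset.univ : Finset Unit) (fun _ => x₂) (fun _ => y₂)
    (fun _ => Q₂)
  have m1 : ∫ φ, W φ * ⟪φ x₂, Q₂ (φ y₂)⟫_ℝ = (∫ φ, W φ) * (G w c M2 x₂ y₂ * trE Q₂) :=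
    moment2_op C η w c M2 hw hM x₂ y₂ Q₂
  have m2 : ∫ φ, W φ * ⟪φ y₁, ContinuousLinearMap.adjoint Q₁ (Q₂ (φ y₂))⟫_ℝ =
      (∫ φ, W φ) * (G w c M2 y₁ y₂ * trE ((ContinuousLinearMap.adjoint Q₁).comp Q₂)) :=
    moment2_op C η w c M2 hw hM y₁ y₂ ((ContinuousLinearMap.adjoint Q₁).comp Q₂)
  have m3 : ∫ φ, W φ * ⟪φ y₁, ContinuousLinearMap.adjoint Q₁ (ContinuousLinearMap.adjoint Q₂ (φ x₂))⟫_ℝ =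
      (∫ φ, W φ) * (G w c M2 y₁ x₂ * trE ((ContinuousLinearMap.adjoint Q₁).comp (ContinuousLinearMap.adjoint Q₂))) :=
    moment2_op C η w c M2 hw hM y₁ x₂ ((ContinuousLinearMap.adjoint Q₁).comp (ContinuousLinearMap.adjoint Q₂))
  simp only [Finset.univ_unique, Finset.prod_singleton, Finset.sum_singleton, Finset.erase_singleton, Finset.prod_empty,
    mul_one] at h
  rw [h, m1, m2, m3]
  ring

/-! ## §4 Currents with powers of `q`: Furry's theorem for the lattice model (p. 434) -/

/-- a `q`-current datum: the current `⟪φ(src), σ·q^{pw} φ(tgt)⟫` with a sign/weight `σ` and the power `pw` of the charge matrix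
(the atoms of `B3WT224HigherOrder` are the case `σ = 1` at a bond). [cite: Balaban1983Higgs3, p.434 ("an odd power of q")] -/
structure QLeg (P : Params) (j : ℕ) where
  /-- the site of the left leg -/
  src : Site P j
  /-- the site of the right leg -/
  tgt : Site P j
  /-- the scalar weight -/
  sgn : ℝ
  /-- the power of `q` -/
  pw : ℕ

/-- the current of a `q`-current datum: `⟪φ(src), σq^{pw}φ(tgt)⟫`. [cite: Balaban1983Higgs3, p.434 ("an odd power of q")] -/
def qleg (d : QLeg P j) (φ : Cfg P j N) : ℝ := ⟪φ d.src, (d.sgn • C.q ^ d.pw) (φ d.tgt)⟫_ℝ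

/-- `qleg` unfolded. [cite: Balaban1983Higgs3, p.434] -/
theorem qleg_apply (d : QLeg P j) (φ : Cfg P j N) : qleg C d φ = ⟪φ d.src, (d.sgn • C.q ^ d.pw) (φ d.tgt)⟫_ℝ := rfl

omit η in
/-- `(q^m)* = (−1)^m q^m` (`q* = −q`, B1 p. 605). [cite: Balaban1982Higgs1, (1.7) p.605] -/
theorem adjoint_qpow (m : ℕ) : ContinuousLinearMap.adjoint (C.q ^ m) = ((-1 : ℝ) ^ m) • C.q ^ m := by
  rw [← ContinuousLinearMap.star_eq_adjoint]
  induction m with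
  | zero => simp
  | succ m ih =>
    conv_lhs => rw [pow_succ, star_mul, ih, C.q_skew, neg_mul, mul_smul_comm, ← pow_succ']
    rw [pow_succ (-1 : ℝ) m, mul_neg_one]
    exact (neg_smul _ _).symm

omit η in
/-- `(σq^m)* = σ(−1)^m q^m`. [cite: Balaban1982Higgs1, (1.7) p.605] -/
theorem adjoint_smul_qpow (σ : ℝ) (m : ℕ) :
    ContinuousLinearMap.adjoint (σ • C.q ^ m) = (σ * (-1 : ℝ) ^ m) • C.q ^ m := by
  rw [LinearIsometryEquiv.map_smulₛₗ, adjoint_qpow, smul_smul]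
  simp

omit η in
/-- the merge of two `q`-currents: `(σq^m)((σ'q^{m'})u) = (σσ')·q^{m+m'}u`. [cite: Balaban1983Higgs3, p.434] -/
theorem sq_apply_sq (σ σ' : ℝ) (m m' : ℕ) (u : EuclideanSpace ℝ (Fin N)) :
    (σ • C.q ^ m) ((σ' • C.q ^ m') u) = ((σ * σ') • C.q ^ (m + m')) u := by
  simp only [smul_apply, map_smul, smul_smul, pow_add, mul_apply_eq_comp]
  rw [mul_comm σ' σ]

omit η in
/-- `⟪v, q^mv⟫ = 0` for odd `m` (an odd power of `q` is antisymmetric). [cite: Balaban1983Higgs3, p.434 ("tr q^{2n+1} = 0")] -/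
theorem inner_qpow_self_odd {m : ℕ} (hm : Odd m) (v : EuclideanSpace ℝ (Fin N)) : ⟪v, (C.q ^ m) v⟫_ℝ = 0 := by
  have h1 : ⟪v, (C.q ^ m) v⟫_ℝ = ⟪ContinuousLinearMap.adjoint (C.q ^ m) v, v⟫_ℝ :=
    (ContinuousLinearMap.adjoint_inner_left _ _ _).symm
  rw [adjoint_qpow, hm.neg_one_pow, smul_apply, real_inner_smul_left, ← real_inner_comm ((C.q ^ m) v) v] at h1
  linarith

omit η in
/-- **`tr(σq^m) = 0` for odd `m`** (p. 434: *"we have tr q^{2n+1} = 0"*), for the basis trace `B3WTCovariance.trE`.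
[cite: Balaban1983Higgs3, p.434] -/
theorem trE_smul_qpow_odd (σ : ℝ) {m : ℕ} (hm : Odd m) : trE (σ • C.q ^ m) = 0 := by
  rw [trE]
  refine Finset.sum_eq_zero fun a _ => ?_
  rw [smul_apply, real_inner_smul_right, inner_qpow_self_odd C hm, mul_zero]

omit C η w c M2 in
/-- replacing one factor of a product over `t ∋ l`: `∏_{l'∈t} f'(l') = f'(l)·∏_{l'∈t∖l} f(l')` when `f' = f` off `l`. [folklore] -/
private theorem prod_eq_mul_prod_erase_of_eq_off {ι : Type*} [DecidableEq ι] {t : Finset ι} {l : ι} (hl : l ∈ t)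
    {f f' : ι → ℝ} (h : ∀ l' ∈ t.erase l, f' l' = f l') : ∏ l' ∈ t, f' l' = f' l * ∏ l' ∈ t.erase l, f l' := by
  rw [← Finset.mul_prod_erase t f' hl, Finset.prod_congr rfl h]

omit C η w c M2 in
/-- the same for sums over `ℕ`. [folklore] -/
private theorem sum_eq_add_sum_erase_of_eq_off {ι : Type*} [DecidableEq ι] {t : Finset ι} {l : ι} (hl : l ∈ t)
    {f f' : ι → ℕ} (h : ∀ l' ∈ t.erase l, f' l' = f l') : ∑ l' ∈ t, f' l' = f' l + ∑ l' ∈ t.erase l, f l' := by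
  rw [← Finset.add_sum_erase t f' hl, Finset.sum_congr rfl h]

/-- **FURRY'S THEOREM FOR THE LATTICE MODEL — the p. 434 mechanism at the level of the Gaussian integrals**: a Gaussian
integral of `q`-currents carrying an ODD total power of `q` vanishes,
`Σ_{l∈s} m_l odd ⟹ ∫dφ e^{−½⟨φ,(−Δ^η+M²)φ⟩} ∏_{l∈s} ⟪φ(x_l), σ_lq^{m_l}φ(y_l)⟫ = 0`.
p. 434, verbatim: *"every graph of this type has at least one loop of scalar field lines with an odd number of vector field legs, thus
with an odd power of q, and we have tr q^{2n+1} = 0"* — here for all loops at once, before any graph is drawn: by induction on the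
number of currents with the first-current recursion (`integral_bil_mul_prod_split`), the leg closing on its own current gives
`tr(σq^m) = 0` if `m` is odd (`trE_smul_qpow_odd`) and leaves an odd total behind if `m` is even, while a merge `(σq^m)*(σ'q^{m'}) =
±σσ'q^{m+m'}` (`adjoint_smul_qpow`, `sq_apply_sq`) preserves the total power.  Consequence for `B3WT224HigherOrder`: at `F = 1` every Wick term of
an even-order identity (total `q`-degree = order + 1) vanishes separately. [cite: Balaban1983Higgs3, p.434] -/
theorem integral_prod_qleg_eq_zero_of_odd (hw : 0 < w) (hM : 0 < M2) {ι : Type*} [DecidableEq ι] (n : ℕ) :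
    ∀ (s : Finset ι) (d : ι → QLeg P j), s.card = n → Odd (∑ l ∈ s, (d l).pw) →
      ∫ φ, W φ * ∏ l ∈ s, qleg C (d l) φ = 0 := by
  induction n using Nat.strong_induction_on with
  | _ n ih =>
  intro s d hcard hodd
  -- the product is non-empty
  obtain ⟨l₀, hl₀⟩ : s.Nonempty := by
    rw [Finset.nonempty_iff_ne_empty]
    rintro rfl
    simp at hodd
  have hlt : (s.erase l₀).card < n := hcard ▸ Finset.card_erase_lt_of_mem hl₀
  -- split off the head current and apply the recursion
  have hsplit : ∀ φ : Cfg P j N, ∏ l ∈ s, qleg C (d l) φ =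
      ⟪φ (d l₀).src, ((d l₀).sgn • C.q ^ (d l₀).pw) (φ (d l₀).tgt)⟫_ℝ *
        ∏ l ∈ s.erase l₀, ⟪φ (d l).src, ((d l).sgn • C.q ^ (d l).pw) (φ (d l).tgt)⟫_ℝ := fun φ => by
    rw [← Finset.mul_prod_erase s _ hl₀]
    rfl
  simp_rw [hsplit]
  rw [integral_bil_mul_prod_split C η w c M2 hw hM _ _ _ (s.erase l₀) (fun l => (d l).src) (fun l => (d l).tgt)
    (fun l => (d l).sgn • C.q ^ (d l).pw)]
  -- the parity bookkeeping
  have hsum : (d l₀).pw + ∑ l ∈ s.erase l₀, (d l).pw = ∑ l ∈ s, (d l).pw :=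
    Finset.add_sum_erase s (fun l => (d l).pw) hl₀
  -- (i) the loop term
  have h0 : G w c M2 (d l₀).src (d l₀).tgt * trE ((d l₀).sgn • C.q ^ (d l₀).pw) *
      ∫ φ, W φ * ∏ l ∈ s.erase l₀, ⟪φ (d l).src, ((d l).sgn • C.q ^ (d l).pw) (φ (d l).tgt)⟫_ℝ = 0 := by
    rcases Nat.even_or_odd (d l₀).pw with hev | hod
    · have hodd' : Odd (∑ l ∈ s.erase l₀, (d l).pw) := by
        rw [← hsum, Nat.odd_add'] at hodd
        exact hodd.mpr hev
      have := ih _ hlt (s.erase l₀) d rfl hodd'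
      simp only [qleg] at this
      rw [this, mul_zero]
    · rw [trE_smul_qpow_odd C _ hod, mul_zero, zero_mul]
  -- (ii) the merge terms
  have hmerge : ∀ l ∈ s.erase l₀,
      G w c M2 (d l₀).src (d l).src *
          (∫ φ, W φ * (⟪φ (d l₀).tgt, ContinuousLinearMap.adjoint ((d l₀).sgn • C.q ^ (d l₀).pw)
              (((d l).sgn • C.q ^ (d l).pw) (φ (d l).tgt))⟫_ℝ *
            ∏ l' ∈ (s.erase l₀).erase l, ⟪φ (d l').src, ((d l').sgn • C.q ^ (d l').pw) (φ (d l').tgt)⟫_ℝ))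
        + G w c M2 (d l₀).src (d l).tgt *
          (∫ φ, W φ * (⟪φ (d l₀).tgt, ContinuousLinearMap.adjoint ((d l₀).sgn • C.q ^ (d l₀).pw)
              (ContinuousLinearMap.adjoint ((d l).sgn • C.q ^ (d l).pw) (φ (d l).src))⟫_ℝ *
            ∏ l' ∈ (s.erase l₀).erase l, ⟪φ (d l').src, ((d l').sgn • C.q ^ (d l').pw) (φ (d l').tgt)⟫_ℝ)) = 0 := by
    intro l hl
    -- first merge: the new current `⟪φ(y₀), ±σ₀σ_l q^{m₀+m_l} φ(y_l)⟫` at the label `l`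
    set d₁ : ι → QLeg P j := Function.update d l
      ⟨(d l₀).tgt, (d l).tgt, (d l₀).sgn * (-1 : ℝ) ^ (d l₀).pw * (d l).sgn, (d l₀).pw + (d l).pw⟩ with hd₁
    have hd₁off : ∀ l' ∈ (s.erase l₀).erase l, d₁ l' = d l' := fun l' hl' =>
      Function.update_of_ne (Finset.ne_of_mem_erase hl') _ _
    have hI₁ : ∫ φ, W φ * (⟪φ (d l₀).tgt, ContinuousLinearMap.adjoint ((d l₀).sgn • C.q ^ (d l₀).pw)
        (((d l).sgn • C.q ^ (d l).pw) (φ (d l).tgt))⟫_ℝ *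
          ∏ l' ∈ (s.erase l₀).erase l, ⟪φ (d l').src, ((d l').sgn • C.q ^ (d l').pw) (φ (d l').tgt)⟫_ℝ) = 0 := by
      have hodd₁ : Odd (∑ l' ∈ s.erase l₀, (d₁ l').pw) := by
        rw [sum_eq_add_sum_erase_of_eq_off hl (f := fun l' => (d l').pw) (f' := fun l' => (d₁ l').pw)
          (fun l' hl' => by simp only [hd₁off l' hl']), hd₁, Function.update_self]
        dsimp only
        rw [add_assoc, Finset.add_sum_erase _ (fun l' => (d l').pw) hl, hsum]
        exact hodd
      have h := ih _ hlt (s.erase l₀) d₁ rfl hodd₁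
      rw [← h]
      refine integral_congr_ae (Filter.Eventually.of_forall fun φ => ?_)
      dsimp only
      rw [prod_eq_mul_prod_erase_of_eq_off hl (f := fun l' => qleg C (d l') φ) (f' := fun l' => qleg C (d₁ l') φ)
        (fun l' hl' => by simp only [hd₁off l' hl'])]
      simp only [qleg, hd₁, Function.update_self, adjoint_smul_qpow, sq_apply_sq]
    -- second merge: the new current `⟪φ(y₀), ±σ₀σ_l q^{m₀+m_l} φ(x_l)⟫` at the label `l`
    set d₂ : ι → QLeg P j := Function.update d l
      ⟨(d l₀).tgt, (d l).src, (d l₀).sgn * (-1 : ℝ) ^ (d l₀).pw * ((d l).sgn * (-1 : ℝ) ^ (d l).pw),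
        (d l₀).pw + (d l).pw⟩ with hd₂
    have hd₂off : ∀ l' ∈ (s.erase l₀).erase l, d₂ l' = d l' := fun l' hl' =>
      Function.update_of_ne (Finset.ne_of_mem_erase hl') _ _
    have hI₂ : ∫ φ, W φ * (⟪φ (d l₀).tgt, ContinuousLinearMap.adjoint ((d l₀).sgn • C.q ^ (d l₀).pw)
        (ContinuousLinearMap.adjoint ((d l).sgn • C.q ^ (d l).pw) (φ (d l).src))⟫_ℝ *
          ∏ l' ∈ (s.erase l₀).erase l, ⟪φ (d l').src, ((d l').sgn • C.q ^ (d l').pw) (φ (d l').tgt)⟫_ℝ) = 0 := by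
      have hodd₂ : Odd (∑ l' ∈ s.erase l₀, (d₂ l').pw) := by
        rw [sum_eq_add_sum_erase_of_eq_off hl (f := fun l' => (d l').pw) (f' := fun l' => (d₂ l').pw)
          (fun l' hl' => by simp only [hd₂off l' hl']), hd₂, Function.update_self]
        dsimp only
        rw [add_assoc, Finset.add_sum_erase _ (fun l' => (d l').pw) hl, hsum]
        exact hodd
      have h := ih _ hlt (s.erase l₀) d₂ rfl hodd₂
      rw [← h]
      refine integral_congr_ae (Filter.Eventually.of_forall fun φ => ?_)
      dsimp only
      rw [prod_eq_mul_prod_erase_of_eq_off hl (f := fun l' => qleg C (d l') φ) (f' := fun l' => qleg C (d₂ l') φ)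
        (fun l' hl' => by simp only [hd₂off l' hl'])]
      simp only [qleg, hd₂, Function.update_self, adjoint_smul_qpow, sq_apply_sq]
    rw [hI₁, hI₂, mul_zero, mul_zero, add_zero]
  rw [h0, Finset.sum_eq_zero hmerge, add_zero]

/-- Furry's theorem, stated without the cardinality parameter. [cite: Balaban1983Higgs3, p.434] -/
theorem integral_prod_qleg_eq_zero_of_odd' (hw : 0 < w) (hM : 0 < M2) {ι : Type*} [DecidableEq ι] (s : Finset ι)
    (d : ι → QLeg P j) (hodd : Odd (∑ l ∈ s, (d l).pw)) : ∫ φ, W φ * ∏ l ∈ s, qleg C (d l) φ = 0 :=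
  integral_prod_qleg_eq_zero_of_odd C η w c M2 hw hM s.card s d rfl hodd

/-- **the three-current integrals of the second-order Ward–Takahashi identity vanish**: for any three bonds or site pairs,
`∫dφ e^{−½⟨φ,(−Δ^η+M²)φ⟩}⟪φ(x₁),qφ(y₁)⟫⟪φ(x₂),qφ(y₂)⟫⟪φ(x₃),qφ(y₃)⟫ = 0` (total power `3`),
and likewise the contact terms
`⟪φ(x₁),qφ(y₁)⟫⟪φ(x₂),q²φ(y₂)⟫` and `⟪φ(x),q³φ(y)⟫` — so at `F = 1` every Wick term of `B3WT224HigherOrder.eq224_secondOrder_zero`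
vanishes separately (p. 434: graphs with one or three external vector legs vanish). [cite: Balaban1983Higgs3, p.434] -/
theorem integral_three_currents_eq_zero (hw : 0 < w) (hM : 0 < M2) (x₁ y₁ x₂ y₂ x₃ y₃ : Site P j) :
    ∫ φ, W φ * (⟪φ x₁, C.q (φ y₁)⟫_ℝ * ⟪φ x₂, C.q (φ y₂)⟫_ℝ * ⟪φ x₃, C.q (φ y₃)⟫_ℝ) = 0 := by
  have h := integral_prod_qleg_eq_zero_of_odd' C η w c M2 hw hM (Finset.univ : Finset (Fin 3))
    (fun i => (⟨![x₁, x₂, x₃] i, ![y₁, y₂, y₃] i, 1, 1⟩ : QLeg P j)) (by show Odd (∑ _i : Fin 3, (1 : ℕ)); decide)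
  simpa [Fin.prod_univ_three, qleg, mul_assoc] using h

/-- the contact terms of the second-order identity vanish too: `∫W⟪φ(x₁),qφ(y₁)⟫⟪φ(x₂),q²φ(y₂)⟫ = 0`. [cite: Balaban1983Higgs3, p.434] -/
theorem integral_current_mul_qsq_eq_zero (hw : 0 < w) (hM : 0 < M2) (x₁ y₁ x₂ y₂ : Site P j) :
    ∫ φ, W φ * (⟪φ x₁, C.q (φ y₁)⟫_ℝ * ⟪φ x₂, (C.q ^ 2) (φ y₂)⟫_ℝ) = 0 := by
  have h := integral_prod_qleg_eq_zero_of_odd' C η w c M2 hw hM (Finset.univ : Finset (Fin 2))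
    (fun i => (⟨![x₁, x₂] i, ![y₁, y₂] i, 1, ![1, 2] i⟩ : QLeg P j))
    (by show Odd (∑ i : Fin 2, (![1, 2] : Fin 2 → ℕ) i); decide)
  simpa [Fin.prod_univ_two, qleg] using h

/-- … and `∫W⟪φ(x),q³φ(y)⟫ = 0`. [cite: Balaban1983Higgs3, p.434] -/
theorem integral_qcube_eq_zero (hw : 0 < w) (hM : 0 < M2) (x y : Site P j) :
    ∫ φ, W φ * ⟪φ x, (C.q ^ 3) (φ y)⟫_ℝ = 0 := by
  have h := integral_prod_qleg_eq_zero_of_odd' C η w c M2 hw hM (Finset.univ : Finset (Fin 1))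
    (fun _ => (⟨x, y, 1, 3⟩ : QLeg P j)) (by show Odd (∑ _i : Fin 1, (3 : ℕ)); decide)
  simpa [Fin.prod_univ_one, qleg] using h

end Literature.MathematicalPhysics.QuantumFieldTheory.Balaban1983to89.B3BilinearWick

end
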